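import Literature.NumberTheory.LFunctions.SmoothedExplicitFormulaChar
import Literature.NumberTheory.LFunctions.ChebyshevHalfLineBiasCharacters
import Mathlib.Analysis.Calculus.SmoothSeries
import Mathlib.Analysis.Calculus.ParametricIntegral
import HarnessLib

/-!
# GRH-CONDITIONAL asymptotics inside GRH-EQUIVALENT criteria (Suzuki 2025, §4.1 eq. (4.5); Thm 8 (4.2) «if»), PROVED — «nothing here bears on the truth of RH»
# The half-line Riesz mean `f_χ(x) = Σ_{n ≤ x} Λ(n)χ(n) n^{-1/2} log(x/n)`: an exact explicit formula (RH-FREE) and `f_χ(x) = −(L'/L)(½, χ) log x + O(1)` under GRH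

LINE 1 — LABEL: RH-FREE literature (an exact explicit formula for a prime sum, proved unconditionally) with one
GRH-CONDITIONAL corollary (the boundedness of its zero term under the GRH for `L(s, χ)`, and the Riesz limit (4.2)
it implies). bears_on: LADDER-RH COLUMN 1 SCREW (S-C, criterion rung: the GRH ⟹ asymptotics halves of Suzuki's
Thms 3, 4, 6, 8, 9). WHAT THIS IS NOT: not a route, not progress toward RH or GRH — under GRH it computes a limit,
without GRH it is an identity; nothing here bears on the truth of RH.

M. Suzuki, *On variants of Chebyshev's conjecture*, Ramanujan J. **68** (2025), no. 4, art. 95 = arXiv:2411.07436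
[`Suzuki2025Chebyshev`; PUBLISHED, refereed], §4.1, proof of **Theorem 8**, AS PRINTED: for a non-principal `χ` and
`f_χ(x) := Σ_{n ≤ x} Λ(n)χ(n) n^{-1/2} log(x/n)` (4.3), «by applying the argument in the proof of [So09] to `L(s)`»,
  `f_χ(x) = −(L'/L)(½) log x − Σ_ρ x^{ρ−1/2}/(ρ−1/2)² − (L'/L)'(½) − Σ_{k ≥ 0} x^{−2k−κ*−1/2}/(2k+κ*+1/2)²`  (4.5)
(`L(½) ≠ 0`, `ρ` over the non-trivial zeros of `L(s, χ*)`), and «Assuming the GRH for `L(s)`, each term of the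
right-hand side (4.5) is bounded except for the first term … Hence, (4.2) … holds», where (4.2) is the Riesz limit
`lim_{x→∞} Σ_{n ≤ x} Λ(n)χ(n) n^{-1/2}(1 − log n/log x) = −(L'/L)(½)` of Theorem 8 (typed in the tree as clause (a) of
the named fact `Suzuki2025Chebyshev_thm8_limits`, `ChebyshevHalfLineBiasCharacters.lean`; Theorem 3 (i) ⟹ (iii) of
`Suzuki2025Chebyshev_thm3`, `ChebyshevHalfLineBiasVariants.lean`, is its case `χ = χ₄`).

## What is proved here, and how (the printed road, through the tree's exact smoothed explicit formula)

The tree does not have [So09]'s formula for the kinked weight `log(x/n) = (L − log n)⁺` (`L = log x`), but it has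
the EXACT smoothed explicit formula of Heath-Brown 1992, Lemma 5.1, for every admissible `C²`-smoothing
(`ExplicitPsiChar.charFordK_eq_explicit`, `SmoothedExplicitFormulaChar.lean`: primitive `χ` mod `q > 1`,
`−1/2 < Re s < 3/2`, `L(s, χ) ≠ 0`). The quadratic weight `h_L(u) = ((L − u)⁺)²/2` IS admissible
(`isSmoothedEFTest_quadWeight`: `h_L = p` on `[0, L]`, `p(L) = p'(L) = 0`), its transform is
`F₀(z) = H₀(z; L) = (−L + (1 − e^{−zL})/z)/z²` (`fordLaplace₀_quadWeight`, from the tree's two integrations by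
parts `fordLaplace₀_eq_of_C2`), and `Σ_n Λ(n)χ(n) n^{-1/2} h_L(log n) = F₂(L)` is the SECOND Riesz mean, whose
`L`-derivative is `f_χ(e^L)` (`hasDerivAt_rieszTwo`: a locally finite sum). Differentiating Heath-Brown's identity
`F₂(L) = −(L²/2)(L'/L)(½) − Σ_ρ m(ρ)H₀(½−ρ; L) − Σ_τ m(τ)H₀(½−τ; L) + J(L)` (`rieszTwo_eq_explicit`) in `L` —
termwise in the zero sum (Mathlib `hasDerivAt_tsum_of_isPreconnected`, dominated by `m(ρ)(1 + e^{M/2})/|½−ρ|²`,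
summable by the tree's `summable_zeroOrder_div_one_add_sq` since the zeros stay away from `½`:
`hasDerivAt_zeroSide`) and under the left-line integral `J` (Mathlib `hasDerivAt_integral_of_dominated_loc_of_deriv_le`
with the tree's `|L'/L(−5/2+iy, χ)| ≤ A + log q + 2 log(1+|y|)`: `hasDerivAt_integral_remIntegrand`) — gives, by
uniqueness of derivatives, the RH-FREE exact formula

  **`f_χ(x) = −(L'/L)(½, χ) log x + Σ_ρ m(ρ)(1 − x^{ρ−½})/(½−ρ)² + Σ_τ m(τ)(1 − x^{τ−½})/(½−τ)² + J'(log x)`**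
  (`halfLineSum_eq_explicit`, `x > 1`; `J'(L) = (1/2π)∫_ℝ (L'/L)(−5/2+iy, χ)(1 − x^{−3+iy})/(3−iy)² dy`),

which is (4.5) with `−(L'/L)'(½) = Σ_{all zeros} (½ − ρ)^{-2}` (Hadamard) distributed over the three sums and the
trivial zeros below `−5/2` inside `J'`. Under the GRH for `L(s, χ)` (the tree's open-strip
`DirichletCharacter.RiemannHypothesis`), `|x^{ρ−½}| = 1`, so `|Σ_ρ| ≤ Σ_ρ 2m(ρ)/|½−ρ|²`
(`norm_zeroSideDeriv_le_of_GRH`); the trivial-zero sum and `J'` are bounded for `x ≥ 1` unconditionally. Hence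

* `exists_norm_halfLineSum_add_le_of_GRH` — **GRH ⟹ `‖f_χ(x) + (L'/L)(½, χ) log x‖ ≤ B` for `x > 1`**
  (primitive `χ` mod `q > 1`, `L(½, χ) ≠ 0`), and
* `tendsto_rieszMean_of_GRH` — **GRH ⟹ (4.2)**, the «if» direction of Thm 8, second half, clause (a), for
  PRIMITIVE characters, with the sum and the limit `−logDeriv χ.LFunction (1/2)` exactly as typed in
  `Suzuki2025Chebyshev_thm8_limits`.

Not proved here (`-- TODO(general form)`): the imprimitive case of (4.2) ⟸ GRH (extra Euler factors
`Π_{p∣q}(1 − χ*(p)p^{-s})`, whose zeros lie on `Re s = 0`), the converse (4.2) ⟹ GRH, the order-`m` version (4.2'),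
and Thms 6/9. Theorems only (D-0014/D-0026): no named facts; the definitions are glue (`quadWeight`, `quadLaplace₀`,
`halfLineSum`, the three sides of the formula).

## References
* [Suzuki2025Chebyshev] M. Suzuki, Ramanujan J. 68 (2025) 95 = arXiv:2411.07436: §4.1 Thm 8, (4.2)–(4.5).
* [HeathBrown1992PLMS] D. R. Heath-Brown, Proc. London Math. Soc. (3) 64 (1992) 265–338, Lemma 5.1 — the tree's
  `SmoothedExplicitFormulaChar.lean` (`charFordK_eq_explicit`).
* [Ford2002Millennium] K. Ford, *Zero-free regions for the Riemann zeta function* (2002), Lemma 4.5 and Remark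
  (`F₀`, two integrations by parts) — the tree's `SmoothedExplicitFormulaPrimeSide.lean`.
* [So09] K. Soundararajan, Ann. of Math. 170 (2009) 981–993 (the formula Suzuki cites for (4.5)).
-/


noncomputable section

open Complex Real MeasureTheory Set Filter Topology ArithmeticFunction

namespace Literature.NumberTheory.LFunctions

namespace HalfLineRiesz

/-! ## §1 The quadratic Riesz weight `h_L(u) = ((L − u)⁺)²/2` and its transform `H₀(z; L)` -/

/-- The quadratic Riesz weight `h_L(u) = ((L − u)⁺)²/2` (so that `Σ_n Λ(n)χ(n) n^{-1/2} h_L(log n) =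
½ Σ_{n ≤ e^L} Λ(n)χ(n) n^{-1/2} log²(e^L/n)`, the second Riesz mean, whose `L`-derivative is `f_χ(e^L)`).
It is an admissible smoothing for the tree's exact explicit formula (`IsSmoothedEFTest`). [folklore] -/
def quadWeight (L u : ℝ) : ℝ := max (L - u) 0 ^ 2 / 2

/-- `h_L(u) = (L − u)²/2` for `u ≤ L`. [folklore] -/
private theorem quadWeight_eq_of_le {L u : ℝ} (h : u ≤ L) : quadWeight L u = (L - u) ^ 2 / 2 := by
  rw [quadWeight, max_eq_left (sub_nonneg.2 h)]

/-- `h_L(u) = 0` for `u ≥ L`. [folklore] -/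
private theorem quadWeight_eq_zero_of_le {L u : ℝ} (h : L ≤ u) : quadWeight L u = 0 := by
  rw [quadWeight, max_eq_right (sub_nonpos.2 h)]
  simp

/-- `h_L(0) = L²/2` (`L ≥ 0`). [folklore] -/
private theorem quadWeight_zero {L : ℝ} (hL : 0 ≤ L) : quadWeight L 0 = L ^ 2 / 2 := by
  rw [quadWeight_eq_of_le hL, sub_zero]

/-- `h_L` is continuous. [folklore] -/
private theorem continuous_quadWeight (L : ℝ) : Continuous (quadWeight L) := by
  unfold quadWeight; fun_prop

/-- `u ↦ max (L − u) 0` is continuous. [folklore] -/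
private theorem continuous_posPart_sub (L : ℝ) : Continuous fun u : ℝ ↦ max (L - u) 0 := by fun_prop

/-- `h_L` is admissible: `h_L = p` on `[0, L]` with `p(u) = (L−u)²/2`, `p' = u − L`, `p'' = 1`,
`p(L) = p'(L) = 0`, `h_L = 0` on `[L, ∞)` — an instance of Ford's admissible class («functions with compact
support and `f''` continuous and bounded»). [cite: Ford2002Millennium, Lemma 4.5 (Remark)] -/
theorem isSmoothedEFTest_quadWeight {L : ℝ} (hL : 0 ≤ L) :
    IsSmoothedEFTest (quadWeight L) (fun u ↦ (L - u) ^ 2 / 2) (fun u ↦ u - L) (fun _ ↦ 1) L where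
  cont := continuous_quadWeight L
  x₀_nonneg := hL
  eqOn := fun t ht ↦ quadWeight_eq_of_le ht.2
  eq_zero := fun u hu ↦ quadWeight_eq_zero_of_le hu
  hasDerivAt := fun t ↦ by
    have h := ((hasDerivAt_id t).const_sub L).pow 2
    have h2 := h.div_const 2
    refine h2.congr_deriv ?_
    simp; ring
  hasDerivAt' := fun t ↦ by
    simpa using (hasDerivAt_id t).sub_const L
  cont'' := continuous_const
  p_x₀ := by simp
  p'_x₀ := by simp

/-- `H₀(z; L) = (−L + (1 − e^{−zL})/z)/z²`, the polar-part-free Laplace transform `F₀` of `h_L`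
(`fordLaplace₀_quadWeight`). [folklore] -/
def quadLaplace₀ (z : ℂ) (L : ℝ) : ℂ := (-(L : ℂ) + (1 - cexp (-(z * L))) / z) / z ^ 2

/-- `∂_L H₀(z; L) = −(1 − e^{−zL})/z²`. [folklore] -/
def quadLaplace₀Deriv (z : ℂ) (L : ℝ) : ℂ := -(1 - cexp (-(z * L))) / z ^ 2

/-- `H₀(z; 0) = 0`. [folklore] -/
@[simp] private theorem quadLaplace₀_zero_right (z : ℂ) : quadLaplace₀ z 0 = 0 := by
  simp [quadLaplace₀]

/-- `∫₀^L e^{−zt} dt = (1 − e^{−zL})/z` (`z ≠ 0`). [folklore] -/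
private theorem integral_cexp_neg_mul {z : ℂ} (hz : z ≠ 0) (L : ℝ) :
    ∫ t in (0 : ℝ)..L, cexp (-(z * t)) = (1 - cexp (-(z * L))) / z := by
  have h := integral_exp_mul_complex (a := 0) (b := L) (neg_ne_zero.2 hz)
  have he : (fun t : ℝ ↦ cexp (-(z * t))) = fun t : ℝ ↦ cexp (-z * t) := by
    funext t; rw [neg_mul]
  rw [he, h]
  simp only [neg_mul, Complex.ofReal_zero, mul_zero, Complex.exp_zero]
  field_simp
  ring

/-- **`F₀` of the quadratic weight**: `fordLaplace₀ h_L z = H₀(z; L)` for `z ≠ 0`, `L ≥ 0`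
(the tree's `fordLaplace₀_eq_of_C2`: `F₀(z) = (p'(0) + ∫₀^L p'' e^{−zt})/z²` with `p'(0) = −L`, `p'' = 1`).
[cite: Ford2002Millennium, Lemma 4.5 (Remark)] -/
theorem fordLaplace₀_quadWeight {L : ℝ} (hL : 0 ≤ L) {z : ℂ} (hz : z ≠ 0) :
    fordLaplace₀ (quadWeight L) z = quadLaplace₀ z L := by
  have h := isSmoothedEFTest_quadWeight hL
  rw [fordLaplace₀_eq_of_C2 h.x₀_nonneg h.eqOn h.eq_zero h.hasDerivAt h.hasDerivAt' h.cont''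
    h.p_x₀ h.p'_x₀ hz, quadLaplace₀]
  simp only [Complex.ofReal_one, one_mul, zero_sub, Complex.ofReal_neg]
  rw [integral_cexp_neg_mul hz]

/-- `L ↦ e^{−zL}` has derivative `−z e^{−zL}`. [folklore] -/
private theorem hasDerivAt_cexp_neg_mul_ofReal (z : ℂ) (L : ℝ) :
    HasDerivAt (fun L : ℝ ↦ cexp (-(z * L))) (-z * cexp (-(z * L))) L := by
  have h1 : HasDerivAt (fun L : ℝ ↦ (L : ℂ)) 1 L := (hasDerivAt_id L).ofReal_comp
  have h2 : HasDerivAt (fun L : ℝ ↦ -(z * (L : ℂ))) (-(z * 1)) L := (h1.const_mul z).neg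
  refine h2.cexp.congr_deriv ?_
  ring

/-- **`∂_L H₀`**: `L ↦ H₀(z; L)` has derivative `−(1 − e^{−zL})/z²` (`z ≠ 0`). [folklore] -/
private theorem hasDerivAt_quadLaplace₀ {z : ℂ} (hz : z ≠ 0) (L : ℝ) :
    HasDerivAt (fun L : ℝ ↦ quadLaplace₀ z L) (quadLaplace₀Deriv z L) L := by
  have h1 : HasDerivAt (fun L : ℝ ↦ (L : ℂ)) 1 L := (hasDerivAt_id L).ofReal_comp
  have he := hasDerivAt_cexp_neg_mul_ofReal z L
  have h2 : HasDerivAt (fun L : ℝ ↦ (-(L : ℂ) + (1 - cexp (-(z * L))) / z) / z ^ 2)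
      ((-1 + (0 - (-z * cexp (-(z * L)))) / z) / z ^ 2) L :=
    (h1.neg.add (((hasDerivAt_const L (1 : ℂ)).sub he).div_const z)).div_const (z ^ 2)
  refine h2.congr_deriv ?_
  rw [quadLaplace₀Deriv]
  field_simp
  ring

/-- `‖∂_L H₀(z; L)‖ ≤ (1 + e^{−Re z · L})/‖z‖²`. [folklore] -/
private theorem norm_quadLaplace₀Deriv_le (z : ℂ) (L : ℝ) :
    ‖quadLaplace₀Deriv z L‖ ≤ (1 + rexp (-(z.re * L))) / ‖z‖ ^ 2 := by
  rw [quadLaplace₀Deriv, norm_div, norm_neg, norm_pow]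
  by_cases hz : z = 0
  · simp [hz]
  gcongr
  refine (norm_sub_le _ _).trans ?_
  rw [norm_one, Complex.norm_exp]
  simp

/-- On `Re z ≥ 0`, `L ≥ 0`: `‖∂_L H₀(z; L)‖ ≤ 2/‖z‖²`. [folklore] -/
private theorem norm_quadLaplace₀Deriv_le_two {z : ℂ} (hz : 0 ≤ z.re) {L : ℝ} (hL : 0 ≤ L) :
    ‖quadLaplace₀Deriv z L‖ ≤ 2 / ‖z‖ ^ 2 := by
  refine (norm_quadLaplace₀Deriv_le z L).trans ?_
  have h1 : rexp (-(z.re * L)) ≤ 1 := by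
    rw [Real.exp_le_one_iff]
    nlinarith
  gcongr
  linarith

/-! ## §2 The prime side: `F₂(L) = K_{h_L,χ}(½)` and `F₂'(L) = f_χ(e^L)` -/

variable {q : ℕ}

/-- `f_χ(x) = Σ_{n ≤ x} Λ(n)χ(n) n^{-1/2} log(x/n)` (Suzuki (4.3); complex-valued; the sum over
`n ∈ Finset.Icc 1 ⌊x⌋₊` as in the tree's typed statements). [cite: Suzuki2025Chebyshev, §4.1 (4.3)] -/
def halfLineSum (χ : DirichletCharacter ℂ q) (x : ℝ) : ℂ :=
  ∑ n ∈ Finset.Icc 1 ⌊x⌋₊, (Λ n : ℂ) * χ n / (Real.sqrt n : ℂ) * (Real.log (x / n) : ℂ)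

/-- The second Riesz mean `F₂(L) = K_{h_L,χ}(½) = Σ_n Λ(n)χ(n) h_L(log n) n^{-1/2}`. [folklore] -/
def rieszTwo (χ : DirichletCharacter ℂ q) (L : ℝ) : ℂ :=
  ExplicitPsiChar.charFordK χ (quadWeight L) (1 / 2)

/-- `φ(x) = (x⁺)²/2` has derivative `x⁺` everywhere. [folklore] -/
private theorem hasDerivAt_posPart_sq_half (x : ℝ) :
    HasDerivAt (fun x : ℝ ↦ max x 0 ^ 2 / 2) (max x 0) x := by
  rcases lt_trichotomy x 0 with hx | rfl | hx
  · -- locally `0`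
    have hev : (fun x : ℝ ↦ max x 0 ^ 2 / 2) =ᶠ[𝓝 x] fun _ ↦ 0 := by
      filter_upwards [Iio_mem_nhds hx] with y hy
      rw [max_eq_right (le_of_lt hy)]; simp
    rw [max_eq_right hx.le]
    exact (hasDerivAt_const x (0 : ℝ)).congr_of_eventuallyEq hev
  · -- at `0`: `|φ(h)| ≤ h²/2 = o(h)`
    rw [max_self]
    rw [hasDerivAt_iff_isLittleO_nhds_zero]
    simp only [zero_add, smul_zero, sub_zero, max_self, ne_eq, OfNat.ofNat_ne_zero,
      not_false_eq_true, zero_pow, zero_div]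
    refine Asymptotics.IsLittleO.of_bound fun c hc ↦ ?_
    filter_upwards [Metric.ball_mem_nhds (0 : ℝ) (by positivity : (0 : ℝ) < 2 * c)] with h hh
    rw [Metric.mem_ball, dist_zero_right, Real.norm_eq_abs] at hh
    rw [Real.norm_eq_abs, Real.norm_eq_abs, abs_div, abs_pow, abs_two]
    have hm : |max h 0| ≤ |h| := by
      rw [abs_of_nonneg (le_max_right _ _)]
      exact max_le (le_abs_self h) (abs_nonneg h)
    have h0 : 0 ≤ |h| := abs_nonneg h
    calc |max h 0| ^ 2 / 2 ≤ |h| ^ 2 / 2 := by gcongr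
      _ = (|h| / 2) * |h| := by ring
      _ ≤ c * |h| := by
          refine mul_le_mul_of_nonneg_right ?_ h0
          linarith
  · -- locally `x²/2`
    have hev : (fun x : ℝ ↦ max x 0 ^ 2 / 2) =ᶠ[𝓝 x] fun y ↦ y ^ 2 / 2 := by
      filter_upwards [Ioi_mem_nhds hx] with y hy
      rw [max_eq_left (le_of_lt hy)]
    rw [max_eq_left hx.le]
    have h := ((hasDerivAt_id x).pow 2).div_const 2
    refine (h.congr_of_eventuallyEq hev).congr_deriv ?_
    simp

/-- `L ↦ h_L(a)` has derivative `(L − a)⁺`. [folklore] -/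
private theorem hasDerivAt_quadWeight_left (a L : ℝ) :
    HasDerivAt (fun L : ℝ ↦ quadWeight L a) (max (L - a) 0) L := by
  have h := (hasDerivAt_posPart_sq_half (L - a)).comp L ((hasDerivAt_id L).sub_const a)
  simpa [quadWeight, Function.comp_def] using h

/-- For `L < log N` (`N ≥ 1`), `F₂(L)` is the finite sum over `n < N`. [folklore] -/
private theorem rieszTwo_eq_sum (χ : DirichletCharacter ℂ q) {N : ℕ} (hN : 1 ≤ N) {L : ℝ} (hL : L ≤ Real.log N) :
    rieszTwo χ L = ∑ n ∈ Finset.range N,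
      ((Λ n : ℝ) : ℂ) * χ n * (quadWeight L (Real.log n) : ℂ) * (n : ℂ) ^ (-(1 / 2 : ℂ)) :=
  ExplicitPsiChar.charFordK_eq_sum χ (fun _ hu ↦ quadWeight_eq_zero_of_le hu) hN hL _

/-- `n^{-1/2} = 1/√n` in `ℂ` for `n ≥ 1`. [folklore] -/
private theorem natCast_cpow_neg_half {n : ℕ} (hn : 1 ≤ n) :
    (n : ℂ) ^ (-(1 / 2 : ℂ)) = 1 / (Real.sqrt n : ℂ) := by
  have hn0 : (0 : ℝ) < n := by exact_mod_cast hn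
  rw [show (n : ℂ) = ((n : ℝ) : ℂ) by norm_cast,
    show (-(1 / 2 : ℂ)) = ((-(1 / 2) : ℝ) : ℂ) by push_cast; ring,
    ← Complex.ofReal_cpow hn0.le, Real.rpow_neg hn0.le, Real.sqrt_eq_rpow]
  push_cast
  ring

/-- **`F₂'(L) = f_χ(e^L)`**: the second Riesz mean is differentiable in `L` with derivative the first
Riesz mean. [folklore] -/
private theorem hasDerivAt_rieszTwo (χ : DirichletCharacter ℂ q) (L : ℝ) :
    HasDerivAt (rieszTwo χ) (halfLineSum χ (rexp L)) L := by
  -- a level `N` with `L + 1 ≤ log N`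
  obtain ⟨N, hN⟩ : ∃ N : ℕ, rexp (L + 1) ≤ N := exists_nat_ge _
  have hN1 : 1 ≤ N := by
    have : (0 : ℝ) < N := (Real.exp_pos _).trans_le hN
    exact_mod_cast this
  have hlogN : L + 1 ≤ Real.log N := by
    have := Real.log_le_log (Real.exp_pos _) hN
    rwa [Real.log_exp] at this
  -- locally `F₂` is the finite sum
  have hev : rieszTwo χ =ᶠ[𝓝 L] fun L' ↦ ∑ n ∈ Finset.range N,
      ((Λ n : ℝ) : ℂ) * χ n * (quadWeight L' (Real.log n) : ℂ) * (n : ℂ) ^ (-(1 / 2 : ℂ)) := by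
    filter_upwards [Iio_mem_nhds (show L < L + 1 by linarith)] with L' hL'
    exact rieszTwo_eq_sum χ hN1 (by linarith [Set.mem_Iio.1 hL'])
  -- differentiate the finite sum termwise
  have hterm : ∀ n ∈ Finset.range N, HasDerivAt
      (fun L' : ℝ ↦ ((Λ n : ℝ) : ℂ) * χ n * (quadWeight L' (Real.log n) : ℂ) * (n : ℂ) ^ (-(1 / 2 : ℂ)))
      (((Λ n : ℝ) : ℂ) * χ n * ((max (L - Real.log n) 0 : ℝ) : ℂ) * (n : ℂ) ^ (-(1 / 2 : ℂ))) L := by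
    intro n _
    have h := (hasDerivAt_quadWeight_left (Real.log n) L).ofReal_comp
    exact ((h.const_mul (((Λ n : ℝ) : ℂ) * χ n)).mul_const ((n : ℂ) ^ (-(1 / 2 : ℂ)))).congr_deriv
      (by ring)
  have hsum := HasDerivAt.fun_sum hterm
  refine (hsum.congr_of_eventuallyEq hev).congr_deriv ?_
  -- identify the derivative with `f_χ(e^L)`
  rw [halfLineSum]
  have hfloor : ⌊rexp L⌋₊ < N := by
    have h1 : (⌊rexp L⌋₊ : ℝ) ≤ rexp L := Nat.floor_le (Real.exp_nonneg _)
    have h2 : rexp L < rexp (L + 1) := Real.exp_lt_exp.2 (by linarith)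
    exact_mod_cast (h1.trans_lt (h2.trans_le hN))
  have hsub : Finset.Icc 1 ⌊rexp L⌋₊ ⊆ Finset.range N := by
    intro n hn
    rw [Finset.mem_Icc] at hn
    rw [Finset.mem_range]
    omega
  rw [← Finset.sum_subset hsub]
  · refine Finset.sum_congr rfl fun n hn ↦ ?_
    rw [Finset.mem_Icc] at hn
    have hn0 : (0 : ℝ) < n := by exact_mod_cast hn.1
    have hnle : (n : ℝ) ≤ rexp L := by
      have := Nat.floor_le (Real.exp_nonneg L)
      exact le_trans (by exact_mod_cast hn.2) this
    have hlog : Real.log n ≤ L := by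
      have := Real.log_le_log hn0 hnle
      rwa [Real.log_exp] at this
    rw [max_eq_left (sub_nonneg.2 hlog), natCast_cpow_neg_half hn.1,
      Real.log_div (Real.exp_pos L).ne' hn0.ne', Real.log_exp]
    push_cast
    ring
  · intro n hn hn'
    rw [Finset.mem_range] at hn
    rw [Finset.mem_Icc, not_and_or, not_le, not_le] at hn'
    rcases hn' with h0 | hbig
    · have : n = 0 := by omega
      subst this
      simp
    · -- `n > e^L`: the weight vanishes
      have hn1 : 1 ≤ n := by
        have := Nat.lt_of_lt_of_le (Nat.zero_lt_succ _) (Nat.succ_le_of_lt hbig)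
        omega
      have hn0 : (0 : ℝ) < n := by exact_mod_cast hn1
      have hgt : rexp L < n := by
        have := Nat.lt_of_floor_lt hbig
        exact_mod_cast this
      have hlog : L ≤ Real.log n := by
        have := Real.log_le_log (Real.exp_pos L) hgt.le
        rwa [Real.log_exp] at this
      rw [max_eq_right (sub_nonpos.2 hlog)]
      simp


/-! ## §3 The zero side `Z(L) = Σ_ρ m(ρ) H₀(½ − ρ; L)` and its termwise derivative -/

section ZeroSide

variable [NeZero q] {χ : DirichletCharacter ℂ q}

open ExplicitPsiChar

/-- The zero side `Z(L) = Σ'_ρ m(ρ) H₀(½ − ρ; L)` of the exact formula for `F₂(L)`, over the non-trivial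
zeros `ρ` of `L(s, χ)` (each once, weight `m(ρ) = DirichletDisc.zeroOrder χ ρ`). [cite: HeathBrown1992PLMS, Lemma 5.1] -/
def zeroSide (χ : DirichletCharacter ℂ q) (L : ℝ) : ℂ :=
  ∑' ρ : charNontrivialZeros χ, (DirichletDisc.zeroOrder χ (ρ : ℂ) : ℂ) * quadLaplace₀ (1 / 2 - ρ) L

/-- Its termwise `L`-derivative `Z'(L) = Σ'_ρ m(ρ) ∂_L H₀(½ − ρ; L) = −Σ'_ρ m(ρ)(1 − x^{ρ−½})/(½ − ρ)²`
(`x = e^L`; absolutely convergent). [cite: Suzuki2025Chebyshev, §4.1 (4.5)] -/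
def zeroSideDeriv (χ : DirichletCharacter ℂ q) (L : ℝ) : ℂ :=
  ∑' ρ : charNontrivialZeros χ, (DirichletDisc.zeroOrder χ (ρ : ℂ) : ℂ) * quadLaplace₀Deriv (1 / 2 - ρ) L

/-- `½ − ρ ≠ 0` for a non-trivial zero when `L(½, χ) ≠ 0`. [folklore] -/
private theorem half_sub_ne_zero (hhalf : χ.LFunction (1 / 2) ≠ 0) (ρ : charNontrivialZeros χ) :
    (1 / 2 : ℂ) - (ρ : ℂ) ≠ 0 := by
  intro h
  have hρ : (ρ : ℂ) = 1 / 2 := (sub_eq_zero.1 h).symm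
  exact hhalf (hρ ▸ ρ.2.1)

/-- `|Re(½ − ρ)| ≤ ½` for a non-trivial zero. [folklore] -/
private theorem abs_re_half_sub_le (ρ : charNontrivialZeros χ) : |((1 / 2 : ℂ) - (ρ : ℂ)).re| ≤ 1 / 2 := by
  have h1 := ρ.2.2.1
  have h2 := ρ.2.2.2
  rw [abs_le, Complex.sub_re]
  norm_num
  constructor <;> linarith

/-- **The summable majorant** `Σ_ρ m(ρ)/‖½ − ρ‖² < ∞` (primitive `χ` mod `q > 1`, `L(½, χ) ≠ 0`): the zeros
stay at distance `≥ d > 0` from `½`, so `1 + γ² ≤ (1/d² + 1)‖½ − ρ‖²`, and `Σ m(ρ)/(1 + γ²) < ∞`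
(`summable_zeroOrder_div_one_add_sq`; the printed input is (2.12), `Σ_ρ |ρ_χ|^{-1-δ} < ∞`).
[cite: Suzuki2025Chebyshev, §2.3 (2.12)] -/
theorem summable_zeroOrder_div_norm_sq (hprim : χ.IsPrimitive) (hq : 1 < q)
    (hhalf : χ.LFunction (1 / 2) ≠ 0) :
    Summable fun ρ : charNontrivialZeros χ ↦
      (DirichletDisc.zeroOrder χ (ρ : ℂ) : ℝ) / ‖(1 / 2 : ℂ) - ρ‖ ^ 2 := by
  have hχ : χ ≠ 1 := ne_one_of_isPrimitive hprim hq
  obtain ⟨d, hd0, -, hd⟩ := exists_dist_charZeros_ge hχ hhalf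
  set C : ℝ := 1 / d ^ 2 + 1 with hC
  refine Summable.of_nonneg_of_le (fun ρ ↦ by positivity) (fun ρ ↦ ?_)
    ((summable_zeroOrder_div_one_add_sq hprim hq).mul_left C)
  have hm : (0 : ℝ) ≤ DirichletDisc.zeroOrder χ (ρ : ℂ) := Nat.cast_nonneg _
  have hdρ : d ≤ ‖(1 / 2 : ℂ) - ρ‖ := hd _ ρ.2
  have hpos : 0 < ‖(1 / 2 : ℂ) - ρ‖ ^ 2 := by
    have : 0 < ‖(1 / 2 : ℂ) - ρ‖ := hd0.trans_le hdρ
    positivity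
  have him : (ρ : ℂ).im ^ 2 ≤ ‖(1 / 2 : ℂ) - ρ‖ ^ 2 := by
    have h := Complex.abs_im_le_norm ((1 / 2 : ℂ) - ρ)
    have him' : ((1 / 2 : ℂ) - ρ).im = -(ρ : ℂ).im := by simp
    rw [him', abs_neg] at h
    nlinarith [abs_nonneg ((ρ : ℂ).im), sq_abs ((ρ : ℂ).im)]
  have hd2 : d ^ 2 ≤ ‖(1 / 2 : ℂ) - ρ‖ ^ 2 := by nlinarith [norm_nonneg ((1 / 2 : ℂ) - ρ)]
  have hkey : 1 + (ρ : ℂ).im ^ 2 ≤ C * ‖(1 / 2 : ℂ) - ρ‖ ^ 2 := by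
    have h1 : (1 : ℝ) ≤ 1 / d ^ 2 * ‖(1 / 2 : ℂ) - ρ‖ ^ 2 := by
      rw [div_mul_eq_mul_div, one_mul, le_div_iff₀ (by positivity), one_mul]
      exact hd2
    calc 1 + (ρ : ℂ).im ^ 2 ≤ 1 / d ^ 2 * ‖(1 / 2 : ℂ) - ρ‖ ^ 2 + ‖(1 / 2 : ℂ) - ρ‖ ^ 2 := by linarith
      _ = C * ‖(1 / 2 : ℂ) - ρ‖ ^ 2 := by rw [hC]; ring
  rw [div_le_iff₀ hpos]
  calc (DirichletDisc.zeroOrder χ (ρ : ℂ) : ℝ)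
      = (DirichletDisc.zeroOrder χ (ρ : ℂ) : ℝ) / (1 + (ρ : ℂ).im ^ 2) * (1 + (ρ : ℂ).im ^ 2) := by
        field_simp
    _ ≤ (DirichletDisc.zeroOrder χ (ρ : ℂ) : ℝ) / (1 + (ρ : ℂ).im ^ 2) * (C * ‖(1 / 2 : ℂ) - ρ‖ ^ 2) :=
        mul_le_mul_of_nonneg_left hkey (by positivity)
    _ = C * ((DirichletDisc.zeroOrder χ (ρ : ℂ) : ℝ) / (1 + (ρ : ℂ).im ^ 2)) * ‖(1 / 2 : ℂ) - ρ‖ ^ 2 := by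
        ring

/-- **Termwise differentiation of the zero side**: for a primitive `χ` mod `q > 1` with `L(½, χ) ≠ 0`,
`Z` is differentiable on `ℝ` with `Z' = zeroSideDeriv` (Mathlib's `hasDerivAt_tsum_of_isPreconnected`
on `(−M, M)`, dominated by `m(ρ)(1 + e^{M/2})/‖½ − ρ‖²`, and `Z(0) = 0`). [folklore] -/
private theorem hasDerivAt_zeroSide (hprim : χ.IsPrimitive) (hq : 1 < q) (hhalf : χ.LFunction (1 / 2) ≠ 0)
    (L : ℝ) : HasDerivAt (zeroSide χ) (zeroSideDeriv χ L) L := by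
  set M : ℝ := |L| + 1 with hM
  have hM0 : 0 < M := by positivity
  set u : charNontrivialZeros χ → ℝ := fun ρ ↦
    (1 + rexp (M / 2)) * ((DirichletDisc.zeroOrder χ (ρ : ℂ) : ℝ) / ‖(1 / 2 : ℂ) - ρ‖ ^ 2) with hu
  have hsu : Summable u := (summable_zeroOrder_div_norm_sq hprim hq hhalf).mul_left _
  have h := hasDerivAt_tsum_of_isPreconnected (t := Set.Ioo (-M) M) (y₀ := 0)
    (g := fun (ρ : charNontrivialZeros χ) (L' : ℝ) ↦
      (DirichletDisc.zeroOrder χ (ρ : ℂ) : ℂ) * quadLaplace₀ (1 / 2 - ρ) L')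
    (g' := fun (ρ : charNontrivialZeros χ) (L' : ℝ) ↦
      (DirichletDisc.zeroOrder χ (ρ : ℂ) : ℂ) * quadLaplace₀Deriv (1 / 2 - ρ) L')
    hsu isOpen_Ioo isPreconnected_Ioo ?_ ?_ (by simp [hM0]) (by simp [summable_zero]) (y := L)
    (by rw [Set.mem_Ioo, hM]; constructor <;> linarith [neg_abs_le L, le_abs_self L])
  · exact h
  · intro ρ y _
    exact (hasDerivAt_quadLaplace₀ (half_sub_ne_zero hhalf ρ) y).const_mul _
  · intro ρ y hy
    rw [Set.mem_Ioo] at hy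
    rw [norm_mul, Complex.norm_natCast, hu]
    have hm : (0 : ℝ) ≤ DirichletDisc.zeroOrder χ (ρ : ℂ) := Nat.cast_nonneg _
    have hb := norm_quadLaplace₀Deriv_le ((1 / 2 : ℂ) - ρ) y
    have hre := abs_re_half_sub_le ρ
    have hexp : rexp (-(((1 / 2 : ℂ) - ρ).re * y)) ≤ rexp (M / 2) := by
      rw [Real.exp_le_exp]
      have hy' : |y| ≤ M := (abs_lt.2 ⟨hy.1, hy.2⟩).le
      have h1 : -(((1 / 2 : ℂ) - ρ).re * y) ≤ |((1 / 2 : ℂ) - ρ).re| * |y| := by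
        rw [← abs_mul]; exact neg_le_abs _
      nlinarith [abs_nonneg y, abs_nonneg (((1 / 2 : ℂ) - ρ).re)]
    have hpos : 0 < ‖(1 / 2 : ℂ) - ρ‖ ^ 2 := by
      have := norm_pos_iff.2 (half_sub_ne_zero hhalf ρ)
      positivity
    calc (DirichletDisc.zeroOrder χ (ρ : ℂ) : ℝ) * ‖quadLaplace₀Deriv (1 / 2 - ρ) y‖
        ≤ (DirichletDisc.zeroOrder χ (ρ : ℂ) : ℝ) * ((1 + rexp (M / 2)) / ‖(1 / 2 : ℂ) - ρ‖ ^ 2) := by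
          refine mul_le_mul_of_nonneg_left (hb.trans ?_) hm
          gcongr
      _ = (1 + rexp (M / 2)) * ((DirichletDisc.zeroOrder χ (ρ : ℂ) : ℝ) / ‖(1 / 2 : ℂ) - ρ‖ ^ 2) := by
          ring

/-- **The zero side under GRH**: if every non-trivial zero has `Re ρ = ½`, then `|x^{ρ−½}| = 1` and
`‖Z'(L)‖ ≤ Σ_ρ 2m(ρ)/‖½ − ρ‖²` for every `L`. [cite: Suzuki2025Chebyshev, §4.1 (proof of Thm 8: «each term … is bounded»)] -/
theorem norm_zeroSideDeriv_le_of_GRH (hprim : χ.IsPrimitive) (hq : 1 < q)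
    (hhalf : χ.LFunction (1 / 2) ≠ 0) (hGRH : χ.RiemannHypothesis) (L : ℝ) :
    ‖zeroSideDeriv χ L‖ ≤
      ∑' ρ : charNontrivialZeros χ, 2 * ((DirichletDisc.zeroOrder χ (ρ : ℂ) : ℝ) / ‖(1 / 2 : ℂ) - ρ‖ ^ 2) := by
  refine tsum_of_norm_bounded ((summable_zeroOrder_div_norm_sq hprim hq hhalf).mul_left 2).hasSum
    fun ρ ↦ ?_
  have hre : ((1 / 2 : ℂ) - (ρ : ℂ)).re = 0 := by
    have := hGRH ρ ρ.2.1 ρ.2.2.1 ρ.2.2.2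
    simp [this]
  have hm : (0 : ℝ) ≤ DirichletDisc.zeroOrder χ (ρ : ℂ) := Nat.cast_nonneg _
  rw [norm_mul, Complex.norm_natCast]
  have hb := norm_quadLaplace₀Deriv_le ((1 / 2 : ℂ) - ρ) L
  rw [hre, zero_mul, neg_zero, Real.exp_zero] at hb
  calc (DirichletDisc.zeroOrder χ (ρ : ℂ) : ℝ) * ‖quadLaplace₀Deriv (1 / 2 - ρ) L‖
      ≤ (DirichletDisc.zeroOrder χ (ρ : ℂ) : ℝ) * ((1 + 1) / ‖(1 / 2 : ℂ) - ρ‖ ^ 2) :=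
        mul_le_mul_of_nonneg_left hb hm
    _ = 2 * ((DirichletDisc.zeroOrder χ (ρ : ℂ) : ℝ) / ‖(1 / 2 : ℂ) - ρ‖ ^ 2) := by ring

end ZeroSide

/-! ## §4 The trivial zeros `τ ∈ [−5/2, 0]` -/

section TrivSide

variable [NeZero q] {χ : DirichletCharacter ℂ q}

open ExplicitPsiChar

/-- `T(L) = Σ_τ m(τ) H₀(½ − τ; L)` over the (at most two) trivial zeros on `[−5/2, 0]`. [folklore] -/
def trivSide (hχ : χ ≠ 1) (L : ℝ) : ℂ :=
  ∑ τ ∈ charTrivialZeroFinset hχ, (DirichletDisc.zeroOrder χ τ : ℂ) * quadLaplace₀ (1 / 2 - τ) L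

/-- `T'(L) = Σ_τ m(τ) ∂_L H₀(½ − τ; L)`. [folklore] -/
def trivSideDeriv (hχ : χ ≠ 1) (L : ℝ) : ℂ :=
  ∑ τ ∈ charTrivialZeroFinset hχ, (DirichletDisc.zeroOrder χ τ : ℂ) * quadLaplace₀Deriv (1 / 2 - τ) L

/-- For a trivial zero `τ`: `Re(½ − τ) ≥ ½`, in particular `½ − τ ≠ 0`. [folklore] -/
private theorem half_le_re_half_sub_triv {hχ : χ ≠ 1} {τ : ℂ} (hτ : τ ∈ charTrivialZeroFinset hχ) :
    1 / 2 ≤ ((1 / 2 : ℂ) - τ).re := by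
  have h := (mem_charTrivialZeroFinset.1 hτ).2.2.1
  simp only [Complex.sub_re]
  norm_num
  linarith

/-- `½ − τ ≠ 0` for a trivial zero `τ`. [folklore] -/
private theorem half_sub_triv_ne_zero {hχ : χ ≠ 1} {τ : ℂ} (hτ : τ ∈ charTrivialZeroFinset hχ) :
    (1 / 2 : ℂ) - τ ≠ 0 := by
  intro h
  have := half_le_re_half_sub_triv hτ
  rw [h, Complex.zero_re] at this
  linarith

/-- `T` is differentiable with `T' = trivSideDeriv`. [folklore] -/
private theorem hasDerivAt_trivSide (hχ : χ ≠ 1) (L : ℝ) :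
    HasDerivAt (trivSide hχ) (trivSideDeriv hχ L) L := by
  unfold trivSide trivSideDeriv
  exact HasDerivAt.fun_sum fun τ hτ ↦ (hasDerivAt_quadLaplace₀ (half_sub_triv_ne_zero hτ) L).const_mul _

/-- `‖T'(L)‖ ≤ Σ_τ 2m(τ)/‖½ − τ‖²` for `L ≥ 0` (the trivial zeros lie on `Re s ≤ 0`).
[cite: MontgomeryVaughan2007, Corollary 10.8] -/
theorem norm_trivSideDeriv_le (hχ : χ ≠ 1) {L : ℝ} (hL : 0 ≤ L) :
    ‖trivSideDeriv hχ L‖ ≤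
      ∑ τ ∈ charTrivialZeroFinset hχ, 2 * ((DirichletDisc.zeroOrder χ τ : ℝ) / ‖(1 / 2 : ℂ) - τ‖ ^ 2) := by
  refine (norm_sum_le _ _).trans (Finset.sum_le_sum fun τ hτ ↦ ?_)
  have hm : (0 : ℝ) ≤ DirichletDisc.zeroOrder χ τ := Nat.cast_nonneg _
  rw [norm_mul, Complex.norm_natCast]
  have hb := norm_quadLaplace₀Deriv_le_two (z := (1 / 2 : ℂ) - τ)
    (by linarith [half_le_re_half_sub_triv hτ]) hL
  calc (DirichletDisc.zeroOrder χ τ : ℝ) * ‖quadLaplace₀Deriv (1 / 2 - τ) L‖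
      ≤ (DirichletDisc.zeroOrder χ τ : ℝ) * (2 / ‖(1 / 2 : ℂ) - τ‖ ^ 2) := mul_le_mul_of_nonneg_left hb hm
    _ = 2 * ((DirichletDisc.zeroOrder χ τ : ℝ) / ‖(1 / 2 : ℂ) - τ‖ ^ 2) := by ring

end TrivSide

/-! ## §5 The left-line remainder `J(L)` and its derivative under the integral sign -/

section RemSide

variable [NeZero q] {χ : DirichletCharacter ℂ q}

open ExplicitPsiChar

/-- The point `−5/2 + iy` of the left line. [folklore] -/
def leftPt (y : ℝ) : ℂ := ((-(5 / 2) : ℝ) : ℂ) + y * I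

/-- `½ − (−5/2 + iy) = 3 − iy`: real part `3`, never zero, `‖·‖² = 9 + y²`. [folklore] -/
private theorem half_sub_leftPt (y : ℝ) : (1 / 2 : ℂ) - leftPt y = (3 : ℂ) - y * I := by
  simp only [leftPt]; push_cast; ring

/-- `Re(½ − (−5/2 + iy)) = 3`. [folklore] -/
private theorem re_half_sub_leftPt (y : ℝ) : ((1 / 2 : ℂ) - leftPt y).re = 3 := by
  rw [half_sub_leftPt]; simp

/-- `½ − (−5/2 + iy) ≠ 0`. [folklore] -/
private theorem half_sub_leftPt_ne_zero (y : ℝ) : (1 / 2 : ℂ) - leftPt y ≠ 0 := by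
  intro h
  have := congrArg Complex.re h
  rw [re_half_sub_leftPt, Complex.zero_re] at this
  norm_num at this

/-- `‖½ − (−5/2 + iy)‖² = 9 + y²`. [folklore] -/
private theorem norm_sq_half_sub_leftPt (y : ℝ) : ‖(1 / 2 : ℂ) - leftPt y‖ ^ 2 = 3 ^ 2 + (0 - y) ^ 2 := by
  rw [half_sub_leftPt, Complex.sq_norm, Complex.normSq_apply]
  simp; ring

/-- `y ↦ −5/2 + iy` is continuous. [folklore] -/
private theorem continuous_leftPt : Continuous leftPt := by
  unfold leftPt; fun_prop

/-- `F(L, y) = −(L'/L)(−5/2 + iy, χ) · H₀(3 − iy; L)`, the left-line integrand of `J(L)`. [folklore] -/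
def remIntegrand (χ : DirichletCharacter ℂ q) (L y : ℝ) : ℂ :=
  -(deriv χ.LFunction (leftPt y) / χ.LFunction (leftPt y)) * quadLaplace₀ (1 / 2 - leftPt y) L

/-- `∂_L F(L, y) = −(L'/L)(−5/2 + iy, χ) · ∂_L H₀(3 − iy; L)`. [folklore] -/
def remIntegrandDeriv (χ : DirichletCharacter ℂ q) (L y : ℝ) : ℂ :=
  -(deriv χ.LFunction (leftPt y) / χ.LFunction (leftPt y)) * quadLaplace₀Deriv (1 / 2 - leftPt y) L

/-- `J(L) = (1/2π) ∫_ℝ F(L, y) dy`. [cite: HeathBrown1992PLMS, Lemma 5.1 (proof)] -/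
def remSide (χ : DirichletCharacter ℂ q) (L : ℝ) : ℂ :=
  (1 / (2 * π) : ℂ) * ∫ y : ℝ, remIntegrand χ L y

/-- `J'(L) = (1/2π) ∫_ℝ ∂_L F(L, y) dy`. [folklore] -/
def remSideDeriv (χ : DirichletCharacter ℂ q) (L : ℝ) : ℂ :=
  (1 / (2 * π) : ℂ) * ∫ y : ℝ, remIntegrandDeriv χ L y

/-- For `L ≥ 0` the tree's remainder `J_χ` of the admissible weight `h_L` at `s = ½` is `J(L)`. [folklore] -/
private theorem charEFRemainder_quadWeight {L : ℝ} (hL : 0 ≤ L) :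
    charEFRemainder χ (quadWeight L) (1 / 2) = remSide χ L := by
  rw [charEFRemainder, remSide]
  congr 1
  refine integral_congr_ae (ae_of_all _ fun y ↦ ?_)
  change charEFIntegrand χ (quadWeight L) (1 / 2) (leftPt y) = remIntegrand χ L y
  rw [charEFIntegrand, remIntegrand, fordLaplace₀_quadWeight hL (half_sub_leftPt_ne_zero y)]

/-- `y ↦ (L'/L)(−5/2 + iy, χ)` is continuous (primitive `χ` mod `q > 1`: `L ≠ 0` on the line). [folklore] -/
private theorem continuous_logDerivL_leftPt (hprim : χ.IsPrimitive) (hq : 1 < q) :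
    Continuous fun y : ℝ ↦ deriv χ.LFunction (leftPt y) / χ.LFunction (leftPt y) := by
  have hχ : χ ≠ 1 := ne_one_of_isPrimitive hprim hq
  obtain ⟨A, -, hA⟩ := exists_norm_logDeriv_LFunction_leftLine_le
  refine continuous_iff_continuousAt.2 fun y ↦ ?_
  have hL : χ.LFunction (leftPt y) ≠ 0 := (hA q χ hprim hq y).1
  have han : AnalyticAt ℂ χ.LFunction (leftPt y) :=
    (DirichletCharacter.differentiable_LFunction hχ).analyticAt _
  have h1 : ContinuousAt (fun w ↦ deriv χ.LFunction w / χ.LFunction w) (leftPt y) :=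
    han.deriv.continuousAt.div han.continuousAt hL
  exact ContinuousAt.comp (x := y) h1 continuous_leftPt.continuousAt

/-- `y ↦ H₀(3 − iy; L)` is continuous. [folklore] -/
private theorem continuous_quadLaplace₀_leftPt (L : ℝ) :
    Continuous fun y : ℝ ↦ quadLaplace₀ (1 / 2 - leftPt y) L := by
  unfold quadLaplace₀
  have hz : Continuous fun y : ℝ ↦ (1 / 2 : ℂ) - leftPt y := continuous_const.sub continuous_leftPt
  have hne : ∀ y, (1 / 2 : ℂ) - leftPt y ≠ 0 := half_sub_leftPt_ne_zero
  refine Continuous.div ?_ (hz.pow 2) (fun y ↦ pow_ne_zero _ (hne y))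
  refine continuous_const.add (Continuous.div ?_ hz hne)
  exact continuous_const.sub (Complex.continuous_exp.comp ((hz.mul continuous_const).neg))

/-- `y ↦ ∂_L H₀(3 − iy; L)` is continuous. [folklore] -/
private theorem continuous_quadLaplace₀Deriv_leftPt (L : ℝ) :
    Continuous fun y : ℝ ↦ quadLaplace₀Deriv (1 / 2 - leftPt y) L := by
  unfold quadLaplace₀Deriv
  have hz : Continuous fun y : ℝ ↦ (1 / 2 : ℂ) - leftPt y := continuous_const.sub continuous_leftPt
  have hne : ∀ y, (1 / 2 : ℂ) - leftPt y ≠ 0 := half_sub_leftPt_ne_zero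
  refine Continuous.div ?_ (hz.pow 2) (fun y ↦ pow_ne_zero _ (hne y))
  exact (continuous_const.sub (Complex.continuous_exp.comp ((hz.mul continuous_const).neg))).neg

/-- `F(L, ·)` is continuous. [folklore] -/
private theorem continuous_remIntegrand (hprim : χ.IsPrimitive) (hq : 1 < q) (L : ℝ) :
    Continuous fun y : ℝ ↦ remIntegrand χ L y :=
  ((continuous_logDerivL_leftPt hprim hq).neg).mul (continuous_quadLaplace₀_leftPt L)

/-- `∂_L F(L, ·)` is continuous. [folklore] -/
private theorem continuous_remIntegrandDeriv (hprim : χ.IsPrimitive) (hq : 1 < q) (L : ℝ) :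
    Continuous fun y : ℝ ↦ remIntegrandDeriv χ L y :=
  ((continuous_logDerivL_leftPt hprim hq).neg).mul (continuous_quadLaplace₀Deriv_leftPt L)

/-- `F(L, ·)` is integrable on `ℝ` for `L ≥ 0` (the tree's `integrable_charIntegrand_left`). [folklore] -/
private theorem integrable_remIntegrand (hprim : χ.IsPrimitive) (hq : 1 < q) {L : ℝ} (hL : 0 ≤ L) :
    Integrable fun y : ℝ ↦ remIntegrand χ L y := by
  have h := integrable_charIntegrand_left hprim hq (isSmoothedEFTest_quadWeight hL) (s := 1 / 2)
    (by norm_num)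
  refine h.congr (ae_of_all _ fun y ↦ ?_)
  change charEFIntegrand χ (quadWeight L) (1 / 2) (leftPt y) = remIntegrand χ L y
  rw [charEFIntegrand, remIntegrand, fordLaplace₀_quadWeight hL (half_sub_leftPt_ne_zero y)]

/-- **Differentiation under the integral sign**: for `L₀ ≥ 0`, `L ↦ ∫ F(L, y) dy` has derivative
`∫ ∂_L F(L₀, y) dy` at `L₀`; the derivative integrand is dominated on `|L − L₀| < 1` by
`(1 + e^{3(|L₀|+1)})(A + log q + 2 log(1 + |y|))/(9 + y²)` (`|L'/L(−5/2 + iy)| ≤ A + log q + 2 log(1+|y|)`,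
the tree's `exists_norm_logDeriv_LFunction_leftLine_le`). [folklore] -/
private theorem hasDerivAt_integral_remIntegrand (hprim : χ.IsPrimitive) (hq : 1 < q) {L₀ : ℝ} (hL₀ : 0 ≤ L₀) :
    Integrable (fun y : ℝ ↦ remIntegrandDeriv χ L₀ y) ∧
    HasDerivAt (fun L : ℝ ↦ ∫ y : ℝ, remIntegrand χ L y) (∫ y : ℝ, remIntegrandDeriv χ L₀ y) L₀ := by
  obtain ⟨A, hA0, hA⟩ := exists_norm_logDeriv_LFunction_leftLine_le
  have hq0 : 0 ≤ Real.log q := Real.log_natCast_nonneg q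
  set K : ℝ := 1 + rexp (3 * (|L₀| + 1)) with hK
  set bound : ℝ → ℝ := fun y ↦ K * ((A + Real.log q + 2 * Real.log (1 + |y|)) / (3 ^ 2 + (0 - y) ^ 2))
    with hbound
  have hbi : Integrable bound :=
    (SmoothedEF.integrable_left_majorant' (A := A + Real.log q) (t := 0) (by positivity)
      (by norm_num : (0 : ℝ) < 3)).const_mul K
  refine hasDerivAt_integral_of_dominated_loc_of_deriv_le (s := Set.Ioo (L₀ - 1) (L₀ + 1))
    (Ioo_mem_nhds (by linarith) (by linarith))
    (Eventually.of_forall fun L ↦ (continuous_remIntegrand hprim hq L).aestronglyMeasurable)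
    (integrable_remIntegrand hprim hq hL₀)
    (continuous_remIntegrandDeriv hprim hq L₀).aestronglyMeasurable
    (ae_of_all _ fun y L hL ↦ ?_) hbi
    (ae_of_all _ fun y L _ ↦ ?_)
  · -- the domination
    rw [Set.mem_Ioo] at hL
    rw [remIntegrandDeriv, norm_mul, norm_neg, hbound]
    obtain ⟨-, hb⟩ := hA q χ hprim hq y
    have hlog0 : 0 ≤ Real.log (1 + |y|) := Real.log_nonneg (by linarith [abs_nonneg y])
    have hC1 : 0 ≤ A + Real.log q + 2 * Real.log (1 + |y|) := by positivity
    have hq' := norm_quadLaplace₀Deriv_le ((1 / 2 : ℂ) - leftPt y) L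
    rw [re_half_sub_leftPt, norm_sq_half_sub_leftPt] at hq'
    have hexp : rexp (-(3 * L)) ≤ rexp (3 * (|L₀| + 1)) := by
      rw [Real.exp_le_exp]
      have : -L ≤ |L₀| + 1 := by
        have h1 : L₀ - 1 < L := hL.1
        have h2 : -L₀ ≤ |L₀| := neg_le_abs L₀
        linarith
      linarith
    have hq'' : ‖quadLaplace₀Deriv (1 / 2 - leftPt y) L‖ ≤ K / (3 ^ 2 + (0 - y) ^ 2) := by
      refine hq'.trans ?_
      rw [hK]
      gcongr
    change ‖deriv χ.LFunction (leftPt y) / χ.LFunction (leftPt y)‖ *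
        ‖quadLaplace₀Deriv (1 / 2 - leftPt y) L‖ ≤ _
    calc ‖deriv χ.LFunction (leftPt y) / χ.LFunction (leftPt y)‖ * ‖quadLaplace₀Deriv (1 / 2 - leftPt y) L‖
        ≤ (A + Real.log q + 2 * Real.log (1 + |y|)) * (K / (3 ^ 2 + (0 - y) ^ 2)) :=
          mul_le_mul hb hq'' (norm_nonneg _) hC1
      _ = K * ((A + Real.log q + 2 * Real.log (1 + |y|)) / (3 ^ 2 + (0 - y) ^ 2)) := by ring
  · -- pointwise derivative
    exact (hasDerivAt_quadLaplace₀ (half_sub_leftPt_ne_zero y) L).const_mul _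

/-- **`J'`**: for `L₀ ≥ 0`, `J` (as `remSide`) has derivative `remSideDeriv χ L₀` at `L₀`. [folklore] -/
private theorem hasDerivAt_remSide (hprim : χ.IsPrimitive) (hq : 1 < q) {L₀ : ℝ} (hL₀ : 0 ≤ L₀) :
    HasDerivAt (remSide χ) (remSideDeriv χ L₀) L₀ := by
  unfold remSide remSideDeriv
  exact (hasDerivAt_integral_remIntegrand hprim hq hL₀).2.const_mul _

/-- **`J'` is bounded**: there is `B_J` with `‖J'(L)‖ ≤ B_J` for all `L ≥ 0`
(on `Re z = 3`, `L ≥ 0`: `‖∂_L H₀(z; L)‖ ≤ 2/‖z‖²`, against the tree's left-line bound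
`|L'/L(−5/2+iy, χ)| ≤ A + log q + 2 log(1+|y|)`, MV Lemma 12.9). [cite: MontgomeryVaughan2007, Lemma 12.9] -/
theorem exists_norm_remSideDeriv_le (hprim : χ.IsPrimitive) (hq : 1 < q) :
    ∃ B : ℝ, ∀ L : ℝ, 0 ≤ L → ‖remSideDeriv χ L‖ ≤ B := by
  obtain ⟨A, hA0, hA⟩ := exists_norm_logDeriv_LFunction_leftLine_le
  have hq0 : 0 ≤ Real.log q := Real.log_natCast_nonneg q
  set g : ℝ → ℝ := fun y ↦ 2 * ((A + Real.log q + 2 * Real.log (1 + |y|)) / (3 ^ 2 + (0 - y) ^ 2))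
    with hg
  have hgi : Integrable g :=
    (SmoothedEF.integrable_left_majorant' (A := A + Real.log q) (t := 0) (by positivity)
      (by norm_num : (0 : ℝ) < 3)).const_mul 2
  refine ⟨‖(1 / (2 * π) : ℂ)‖ * ∫ y, g y, fun L hL ↦ ?_⟩
  rw [remSideDeriv, norm_mul]
  refine mul_le_mul_of_nonneg_left ?_ (norm_nonneg _)
  refine norm_integral_le_of_norm_le hgi (ae_of_all _ fun y ↦ ?_)
  rw [remIntegrandDeriv, norm_mul, norm_neg, hg]
  obtain ⟨-, hb⟩ := hA q χ hprim hq y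
  have hlog0 : 0 ≤ Real.log (1 + |y|) := Real.log_nonneg (by linarith [abs_nonneg y])
  have hC1 : 0 ≤ A + Real.log q + 2 * Real.log (1 + |y|) := by positivity
  have hq' := norm_quadLaplace₀Deriv_le_two (z := (1 / 2 : ℂ) - leftPt y)
    (by rw [re_half_sub_leftPt]; norm_num) hL
  rw [norm_sq_half_sub_leftPt] at hq'
  change ‖deriv χ.LFunction (leftPt y) / χ.LFunction (leftPt y)‖ *
      ‖quadLaplace₀Deriv (1 / 2 - leftPt y) L‖ ≤ _
  calc ‖deriv χ.LFunction (leftPt y) / χ.LFunction (leftPt y)‖ * ‖quadLaplace₀Deriv (1 / 2 - leftPt y) L‖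
      ≤ (A + Real.log q + 2 * Real.log (1 + |y|)) * (2 / (3 ^ 2 + (0 - y) ^ 2)) :=
        mul_le_mul hb hq' (norm_nonneg _) hC1
    _ = 2 * ((A + Real.log q + 2 * Real.log (1 + |y|)) / (3 ^ 2 + (0 - y) ^ 2)) := by ring

end RemSide


/-! ## §6 The exact formula: Heath-Brown's identity for `F₂(L)`, differentiated in `L` -/

section Assembly

variable [NeZero q] {χ : DirichletCharacter ℂ q}

open ExplicitPsiChar

/-- **The exact smoothed explicit formula at `s = ½` with the weight `h_L`** (`L ≥ 0`, primitive `χ` mod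
`q > 1`, `L(½, χ) ≠ 0`): `F₂(L) = −(L²/2)(L'/L)(½, χ) − Z(L) − T(L) + J(L)` — the tree's
`ExplicitPsiChar.charFordK_eq_explicit` (Heath-Brown 1992, Lemma 5.1) with `F₀ = H₀(·; L)`.
[cite: HeathBrown1992PLMS, Lemma 5.1] -/
theorem rieszTwo_eq_explicit (hprim : χ.IsPrimitive) (hq : 1 < q) (hhalf : χ.LFunction (1 / 2) ≠ 0)
    {L : ℝ} (hL : 0 ≤ L) :
    rieszTwo χ L = -((L ^ 2 / 2 : ℝ) : ℂ) * (deriv χ.LFunction (1 / 2) / χ.LFunction (1 / 2))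
      - zeroSide χ L - trivSide (ne_one_of_isPrimitive hprim hq) L + remSide χ L := by
  have h := charFordK_eq_explicit hprim hq (isSmoothedEFTest_quadWeight hL) (s := 1 / 2)
    (by norm_num) (by norm_num) hhalf
  rw [rieszTwo, h, quadWeight_zero hL, charEFRemainder_quadWeight hL, zeroSide, trivSide]
  congr 2
  · congr 1
    refine tsum_congr fun ρ ↦ ?_
    rw [fordLaplace₀_quadWeight hL (half_sub_ne_zero hhalf ρ)]
  · refine Finset.sum_congr rfl fun τ hτ ↦ ?_
    rw [fordLaplace₀_quadWeight hL (half_sub_triv_ne_zero hτ)]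

/-- **Exact explicit formula for the half-line Riesz mean** (Suzuki 2025, (4.5)/(4.4'): the `s = ½` case
of the [So09]-type formula, here in the derivative form obtained from Heath-Brown's exact smoothed formula),
RH-FREE, for a primitive `χ` mod `q > 1` with `L(½, χ) ≠ 0` and every `x > 1`:
`f_χ(x) = −(L'/L)(½, χ) log x − Z'(log x) − T'(log x) + J'(log x)`, where
`−Z'(log x) = Σ_ρ m(ρ)(1 − x^{ρ−½})/(½ − ρ)²` (non-trivial zeros, absolutely convergent),
`−T'(log x) = Σ_τ m(τ)(1 − x^{τ−½})/(½ − τ)²` (trivial zeros on `[−5/2, 0]`), and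
`J'(log x) = (1/2π)∫_ℝ (L'/L)(−5/2 + iy, χ)(1 − x^{−3+iy})/(3 − iy)² dy`. Compared with the printed (4.5),
`−(L'/L)'(½) = Σ_{all zeros} 1/(½ − ρ)²` (Hadamard) is distributed over the three sums.
[cite: Suzuki2025Chebyshev, §4.1 (4.5) and (4.4')] [cite: HeathBrown1992PLMS, Lemma 5.1] -/
theorem halfLineSum_eq_explicit (hprim : χ.IsPrimitive) (hq : 1 < q) (hhalf : χ.LFunction (1 / 2) ≠ 0)
    {x : ℝ} (hx : 1 < x) :
    halfLineSum χ x = -(Real.log x : ℂ) * (deriv χ.LFunction (1 / 2) / χ.LFunction (1 / 2))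
      - zeroSideDeriv χ (Real.log x) - trivSideDeriv (ne_one_of_isPrimitive hprim hq) (Real.log x)
      + remSideDeriv χ (Real.log x) := by
  set hχ := ne_one_of_isPrimitive hprim hq
  set D : ℂ := deriv χ.LFunction (1 / 2) / χ.LFunction (1 / 2) with hD
  set L₀ : ℝ := Real.log x with hL₀
  have hL₀pos : 0 < L₀ := Real.log_pos hx
  -- the right-hand side as a function of `L` and its derivative at `L₀`
  set R : ℝ → ℂ := fun L ↦ -((L ^ 2 / 2 : ℝ) : ℂ) * D - zeroSide χ L - trivSide hχ L + remSide χ L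
    with hR
  have hsq : HasDerivAt (fun L : ℝ ↦ ((L ^ 2 / 2 : ℝ) : ℂ)) (L₀ : ℂ) L₀ := by
    have h := (((hasDerivAt_id L₀).pow 2).div_const 2).ofReal_comp
    refine h.congr_deriv ?_
    simp
  have hRd : HasDerivAt R (-(L₀ : ℂ) * D - zeroSideDeriv χ L₀ - trivSideDeriv hχ L₀ + remSideDeriv χ L₀) L₀ :=
    (((hsq.neg.mul_const D).sub (hasDerivAt_zeroSide hprim hq hhalf L₀)).sub
      (hasDerivAt_trivSide hχ L₀)).add (hasDerivAt_remSide hprim hq hL₀pos.le)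
  -- `F₂ = R` near `L₀`
  have hev : rieszTwo χ =ᶠ[𝓝 L₀] R := by
    filter_upwards [Ioi_mem_nhds hL₀pos] with L hL
    exact rieszTwo_eq_explicit hprim hq hhalf (le_of_lt hL)
  have h1 : HasDerivAt (rieszTwo χ) (-(L₀ : ℂ) * D - zeroSideDeriv χ L₀ - trivSideDeriv hχ L₀
      + remSideDeriv χ L₀) L₀ := hRd.congr_of_eventuallyEq hev
  have h2 := hasDerivAt_rieszTwo χ L₀
  rw [hL₀, Real.exp_log (by linarith)] at h2
  exact h2.unique h1

/-! ## §7 Under GRH: `f_χ(x) = −(L'/L)(½, χ) log x + O(1)` and the Riesz limit (4.2) -/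

/-- **Suzuki 2025, (4.5) under GRH, PROVED**: for a primitive `χ` mod `q > 1` with `L(½, χ) ≠ 0`, if the
GRH holds for `L(s, χ)` (the tree's open-strip `DirichletCharacter.RiemannHypothesis`), then
`‖f_χ(x) + (L'/L)(½, χ) log x‖ ≤ B` for all `x > 1` («each term of the right-hand side (4.5) is bounded
except for the first term»). GRH-CONDITIONAL. [cite: Suzuki2025Chebyshev, §4.1 Thm 8 (proof, (4.5))] -/
theorem exists_norm_halfLineSum_add_le_of_GRH (hprim : χ.IsPrimitive) (hq : 1 < q)
    (hhalf : χ.LFunction (1 / 2) ≠ 0) (hGRH : χ.RiemannHypothesis) :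
    ∃ B : ℝ, ∀ x : ℝ, 1 < x →
      ‖halfLineSum χ x + (Real.log x : ℂ) * (deriv χ.LFunction (1 / 2) / χ.LFunction (1 / 2))‖ ≤ B := by
  set hχ := ne_one_of_isPrimitive hprim hq
  obtain ⟨BJ, hBJ⟩ := exists_norm_remSideDeriv_le (χ := χ) hprim hq
  set BZ : ℝ := ∑' ρ : charNontrivialZeros χ,
    2 * ((DirichletDisc.zeroOrder χ (ρ : ℂ) : ℝ) / ‖(1 / 2 : ℂ) - ρ‖ ^ 2)
  set BT : ℝ := ∑ τ ∈ charTrivialZeroFinset hχ, 2 * ((DirichletDisc.zeroOrder χ τ : ℝ) / ‖(1 / 2 : ℂ) - τ‖ ^ 2)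
  refine ⟨BZ + BT + BJ, fun x hx ↦ ?_⟩
  have hL : 0 ≤ Real.log x := (Real.log_pos hx).le
  have heq : halfLineSum χ x + (Real.log x : ℂ) * (deriv χ.LFunction (1 / 2) / χ.LFunction (1 / 2)) =
      -zeroSideDeriv χ (Real.log x) - trivSideDeriv hχ (Real.log x) + remSideDeriv χ (Real.log x) := by
    rw [halfLineSum_eq_explicit hprim hq hhalf hx]; ring
  rw [heq]
  have h1 := norm_zeroSideDeriv_le_of_GRH hprim hq hhalf hGRH (Real.log x)
  have h2 := norm_trivSideDeriv_le hχ hL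
  have h3 := hBJ _ hL
  calc ‖-zeroSideDeriv χ (Real.log x) - trivSideDeriv hχ (Real.log x) + remSideDeriv χ (Real.log x)‖
      ≤ ‖-zeroSideDeriv χ (Real.log x) - trivSideDeriv hχ (Real.log x)‖ + ‖remSideDeriv χ (Real.log x)‖ :=
        norm_add_le _ _
    _ ≤ ‖-zeroSideDeriv χ (Real.log x)‖ + ‖trivSideDeriv hχ (Real.log x)‖ + ‖remSideDeriv χ (Real.log x)‖ := by
        gcongr; exact norm_sub_le _ _
    _ ≤ BZ + BT + BJ := by rw [norm_neg]; gcongr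

omit [NeZero q] in
/-- The Riesz mean of the typed statements is `f_χ(x)/log x` (`x > 1`):
`Σ_{n ≤ x} Λ(n)χ(n) n^{-1/2}(1 − log n/log x) = f_χ(x)/log x`. [cite: Suzuki2025Chebyshev, §4.1 (4.2)–(4.3)] -/
theorem rieszMean_eq_halfLineSum_div (χ : DirichletCharacter ℂ q) {x : ℝ} (hx : 1 < x) :
    ∑ n ∈ Finset.Icc 1 ⌊x⌋₊,
        (Λ n : ℂ) * χ (n : ZMod q) / (Real.sqrt n : ℂ) * ((1 - Real.log n / Real.log x : ℝ) : ℂ) =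
      halfLineSum χ x / (Real.log x : ℂ) := by
  have hlx : Real.log x ≠ 0 := (Real.log_pos hx).ne'
  rw [halfLineSum, Finset.sum_div]
  refine Finset.sum_congr rfl fun n hn ↦ ?_
  rw [Finset.mem_Icc] at hn
  have hn0 : (0 : ℝ) < n := by exact_mod_cast hn.1
  have h1 : (1 - Real.log n / Real.log x : ℝ) = Real.log (x / n) / Real.log x := by
    rw [Real.log_div (by linarith) hn0.ne']
    field_simp
  rw [h1]
  push_cast
  ring

/-- **Suzuki 2025, Thm 8, (4.2), «if» direction, PROVED for primitive characters**: for a primitive `χ`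
mod `q > 1` with `L(½, χ) ≠ 0`, the GRH for `L(s, χ)` implies
`lim_{x→∞} Σ_{n ≤ x} Λ(n)χ(n) n^{-1/2}(1 − log n/log x) = −(L'/L)(½, χ)` — the sum and limit in the form typed
in `Suzuki2025Chebyshev_thm8_limits` (clause (a), direction GRH ⟹ (4.2); the imprimitive case and the
converse are not proved here). GRH-CONDITIONAL clause of a GRH-EQUIVALENT criterion.
[cite: Suzuki2025Chebyshev, §4.1 Thm 8 ((4.2) ⟸ GRH)] -/
theorem tendsto_rieszMean_of_GRH (hprim : χ.IsPrimitive) (hq : 1 < q)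
    (hhalf : χ.LFunction (1 / 2) ≠ 0) (hGRH : χ.RiemannHypothesis) :
    Tendsto (fun x : ℝ ↦ ∑ n ∈ Finset.Icc 1 ⌊x⌋₊,
        (Λ n : ℂ) * χ (n : ZMod q) / (Real.sqrt n : ℂ) * ((1 - Real.log n / Real.log x : ℝ) : ℂ))
      atTop (𝓝 (-logDeriv χ.LFunction (1 / 2))) := by
  obtain ⟨B, hB⟩ := exists_norm_halfLineSum_add_le_of_GRH hprim hq hhalf hGRH
  set D : ℂ := deriv χ.LFunction (1 / 2) / χ.LFunction (1 / 2) with hD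
  rw [logDeriv_apply, ← hD]
  rw [← tendsto_sub_nhds_zero_iff]
  have hlim : Tendsto (fun x : ℝ ↦ B * (Real.log x)⁻¹) atTop (𝓝 0) := by
    have h := (tendsto_inv_atTop_zero.comp Real.tendsto_log_atTop).const_mul B
    rw [mul_zero] at h
    exact h
  refine squeeze_zero_norm' ?_ hlim
  filter_upwards [eventually_gt_atTop (1 : ℝ)] with x hx
  have hlx : 0 < Real.log x := Real.log_pos hx
  have hlxC : (Real.log x : ℂ) ≠ 0 := by exact_mod_cast hlx.ne'
  rw [rieszMean_eq_halfLineSum_div χ hx]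
  have heq : halfLineSum χ x / (Real.log x : ℂ) - -D =
      (halfLineSum χ x + (Real.log x : ℂ) * D) / (Real.log x : ℂ) := by
    field_simp
    ring
  rw [heq, norm_div, Complex.norm_real, Real.norm_eq_abs, abs_of_pos hlx, div_eq_mul_inv]
  exact mul_le_mul_of_nonneg_right (hB x hx) (inv_nonneg.2 hlx.le)

end Assembly

end HalfLineRiesz

end Literature.NumberTheory.LFunctions

end
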